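import Mathlib
import HarnessLib
import Literature.MathematicalPhysics.StatisticalMechanics.RenormalisationMapRemainderTwoLargeKernelSub

/-!
# The large remainder sum `Σ₂ᴸ` of `S_k` for TWO STEP KERNELS at a FIXED extracted Hamiltonian:
# the kernel-only piece, linear in the pair constant `ℓ` ([ABKM19] Theorem 6.8 ⊗ Lemma 8.4; (12.53))

`RenormalisationMapRemainderTwoLargeKernelSub.tayNormLE_remainderTwoLarge_kernel_sub_abkm` compares
`Σ₂ᴸ,a(H̃)` and `Σ₂ᴸ,b(H̃')` (two kernels AND two extracted Hamiltonians) with a bound `(1 + ℓ)·[…]` whose bracket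
carries the non-small letters `8e^{1/4}‖H‖_{k,0}` and `C`; that form does not vanish as the kernels merge.  For the
volume-uniform `q`-Lipschitz bound of `S_k` (child `TwoKernelSkBound` of the cruxes `HypACumulant` / `HypALocalTwoPoint`
of the route `Summits/HubbardSuperconductivity/…/Theses/ComplexGFFStiffness`, line `banach_two_kernel`) the difference is
split as `[Σ₂ᴸ,a(H̃_a) − Σ₂ᴸ,a(H̃_b)] + [Σ₂ᴸ,a(H̃_b) − Σ₂ᴸ,b(H̃_b)]`: the first bracket is the landed ONE-kernel Lipschitz
bound (`tayNormLE_remainderTwoLarge_sub_abkm_of_stepKernelBounds` with `H' = H`, `K' = K`), the second is THIS file: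

* **`tayNormLE_remainderTwoLarge_kernelOnly_sub_abkm`** — for the SAME extracted Hamiltonian `H̃` on both sides,
  `|Σ₂ᴸ,a(H̃) − Σ₂ᴸ,b(H̃)|_{T_{k+1}^{U*}, w_{k+1}^U} ≤ ℓ · [κ^{|U|_k}(8e^{1/4}‖H‖ + C)(ωA⁴)·c₃^{|U|_{k+1}}A^{−η|U|_{k+1}}
  + κ^{|U|_k}·C·c₂^{|U|_{k+1}}A^{−η|U|_{k+1}}]` — LINEAR in the pair constant `ℓ` of Lemma 8.4 (so `O(|q'−q|₁)` once
  `ℓ` is), with the per-block constant `max(A_{𝒫,a}, κ_p)` inside `c₂, c₃` and any `κ ≥ 1 + e^{1/4}`.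

Proof: the proof of the two-Hamiltonian twin verbatim with `H̃' := H̃` (the three `H̃`-variation summands of the
two-kernel subsum tool vanish identically), the slot majorisation `kernelSlot_le_letterSlot` keeping its factor `ℓ`
OUTSIDE, then the abstract adapters `reblockTerm_lipschitzConsts_le[_top]` (letters `Δ := 0`, `Δ_H := 8e^{1/4}‖H‖`,
`C_Δ := C`) and the master counting lemmas.  No smallness in `ℓ` is needed.  Everything is proved; no named fact.

## References
* S. Adams, S. Buchholz, R. Kotecký, S. Müller, arXiv:1910.13564, Theorem 6.8 ((6.59)–(6.60)), Lemma 9.6 (proof),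
  Lemma 8.4, Lemma 12.6 (12.53) [AdamsBuchholzKoteckyMuller2019].
-/

noncomputable section

namespace Literature.MathematicalPhysics.StatisticalMechanics.GradientRG

open scoped BigOperators Classical
open Finset Matrix MeasureTheory
open Literature.MathematicalPhysics.StatisticalMechanics.TorusPolymer
  (IsPolymer blocks polys bprod blockOf thicken reblock boxCorner mem_polys mem_blocks numBlocks isPolymer_blockOf
    card_blocks_eq_numBlocks blocks_blockOf empty_mem_polys closure reblockTerm_lipschitzConsts_le
    reblockTerm_lipschitzConsts_le_top sum_reblock_triples_le_pow sum_reblock_large_le_pow self_mem_polys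
    bprod_empty two_le_degree_of_ne_self two_le_degree_self_of_not_isConn two_le_card_blocks_of_not_isConn
    reblock_empty two_le_degree_of_ssubset)
open Literature.Barriers.CriticalPhenomena.LongRangePhi4.Polymer (IsConn components)
open Literature.MathematicalPhysics.StatisticalMechanics.GradientFRD (iterDiff)
open Literature.MathematicalPhysics.QuantumFieldTheory

variable {d M : ℕ} [NeZero M]

set_option maxHeartbeats 1600000 in
/-- **Kernel-only two-kernel piece of `Σ₂ᴸ`, linear in `ℓ`** (module docstring): the SAME `(H̃, H, K)` on both sides
(`‖H̃‖_{k,0} ≤ τ ≤ 1/16`, `‖H‖_{k,0} ≤ 1/16`, `‖K‖_k ≤ C`), two step kernels `𝒞a, 𝒞b` with `StepKernelBounds` relative to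
the `q = 0` weights and the pair property `hdiff` on `Y ⊆ U + [−r,r]^d` (`‖R_aF − R_bF‖ ≤ b·ℓ·κ_p^{|Y|_k}`); letters
`8e^{1/4}τ ≤ ω`, `2·8e^{1/4}‖H‖_{k,0} ≤ ω`, `2C ≤ ω`, `ωA² ≤ 1`, `κ ≥ 1 + e^{1/4}`.  The bound is `ℓ` times the one-kernel
`Σ₂ᴸ` Lipschitz constant with the letters `Δ := 0`, `Δ_H := 8e^{1/4}‖H‖_{k,0}`, `C_Δ := C`, `A_𝒫 := max(A_{𝒫,a}, κ_p)`.
[cite: AdamsBuchholzKoteckyMuller2019, Theorem 6.8 / Lemma 9.6 (proof, first order) / Lemma 12.6 (12.53)] -/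
theorem tayNormLE_remainderTwoLarge_kernelOnly_sub_abkm {L N Mord R n p r₀ : ℕ}
    {θbar lam μ δ₁ δ₀ A𝒫 A𝒫a A𝒫b C₂a C₂b h A : ℝ}
    {𝒞 : ℕ → (Fin d → ZMod M) → ℝ} (hd : 3 ≤ d) (hLodd : Odd L) (hL : 2 ^ (d + 3) + 16 * R ≤ L)
    (hR2 : 2 ≤ R) (hM : M = L ^ N) {k : ℕ} (hkN : k + 1 ≤ N)
    {𝒞a 𝒞b : (Fin d → ZMod M) → ℝ}
    (hSa : StepKernelBounds (abkmWeightData L N Mord R θbar (schedDelta δ₀ δ₁ N) 𝒞) L k A𝒫a C₂a 𝒞a)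
    (hSb : StepKernelBounds (abkmWeightData L N Mord R θbar (schedDelta δ₀ δ₁ N) 𝒞) L k A𝒫b C₂b 𝒞b)
    (hp : d / 2 + 1 ≤ p) (hMord : d / 2 + 1 ≤ Mord)
    (hB : AbkmWeightBounds L N Mord R n θbar lam μ δ₁ δ₀ A𝒫 𝒞
      (abkmWeightData L N Mord R θbar (schedDelta δ₀ δ₁ N) 𝒞))
    (hδ₀ : 0 < δ₀) (hδ₁ : 0 < δ₁) (hh : 0 < h) (hh0 : hZeroSq d R δ₀ δ₁ ≤ h ^ 2) (hA𝒫 : 0 ≤ A𝒫a) (hA1 : 1 ≤ A)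
    {U : Finset (Fin d → ZMod M)} (hU : IsPolymer (L ^ (k + 1)) U)
    {Ht H : RelevantHamiltonian ℂ d} {τ : ℝ}
    (hHt : hamNorm (fieldWt h (L : ℝ) d k) ((L : ℝ) ^ k) (L ^ (d * k)) Ht ≤ τ) (hτ : τ ≤ 1 / 16)
    (hH : hamNorm (fieldWt h (L : ℝ) d k) ((L : ℝ) ^ k) (L ^ (d * k)) H ≤ 1 / 16)
    {K : Finset (Fin d → ZMod M) → ((Fin d → ZMod M) → ℝ) → ℂ} {C : ℝ} (hC : 0 ≤ C)
    (hK : WeakNormLE (abkmNormParams L N Mord R p r₀ h θbar A (schedDelta δ₀ δ₁ N) 𝒞) k K C)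
    (hKfac : Factorises (L ^ k) K) (hK0 : ∀ φ, K ∅ φ = 1) (hKd : ∀ Y, ContDiff ℝ r₀ (K Y))
    (hKloc : ∀ Y, IsPolymer (L ^ k) Y → IsConn Y →
      IsGaugeLocal ((abkmNormParams L N Mord R p r₀ h θbar A (schedDelta δ₀ δ₁ N) 𝒞).gauge k Y) (K Y))
    {ℓ κp : ℝ} (hℓ : 0 ≤ ℓ) (hκp : 0 ≤ κp)
    (hdiff : ∀ X : Finset (Fin d → ZMod M), IsPolymer (L ^ k) X → X ⊆ thicken ((2 ^ d - 1) * L ^ k) U →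
      ∀ (F : ((Fin d → ZMod M) → ℝ) → ℂ) (b : ℝ), 0 ≤ b → ContDiff ℝ r₀ F →
        IsGaugeLocal ((abkmNormParams L N Mord R p r₀ h θbar A (schedDelta δ₀ δ₁ N) 𝒞).gauge k X) F →
        TayNormLE ((abkmNormParams L N Mord R p r₀ h θbar A (schedDelta δ₀ δ₁ N) 𝒞).gauge k X) r₀
          ((abkmWeightData L N Mord R θbar (schedDelta δ₀ δ₁ N) 𝒞).weight k X) F b →
          TayNormLE ((abkmNormParams L N Mord R p r₀ h θbar A (schedDelta δ₀ δ₁ N) 𝒞).gauge k X) r₀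
            ((abkmWeightData L N Mord R θbar (schedDelta δ₀ δ₁ N) 𝒞).midWeight k X)
            (fluct 𝒞a F - fluct 𝒞b F) (b * ℓ * κp ^ numBlocks (L ^ k) X))
    {ω κ : ℝ}
    (hθω : 8 * Real.exp (1 / 4) * τ ≤ ω)
    (hbbω : 8 * Real.exp (1 / 4) * hamNorm (fieldWt h (L : ℝ) d k) ((L : ℝ) ^ k) (L ^ (d * k)) H +
      8 * Real.exp (1 / 4) * hamNorm (fieldWt h (L : ℝ) d k) ((L : ℝ) ^ k) (L ^ (d * k)) H ≤ ω)
    (hCω : C + C ≤ ω) (hωA : ω * A ^ 2 ≤ 1)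
    (hκ : 1 + Real.exp (1 / 4) ≤ κ) :
    TayNormLE ((abkmNormParams L N Mord R p r₀ h θbar A (schedDelta δ₀ δ₁ N) 𝒞).gauge (k + 1) U) r₀
      ((abkmWeightData L N Mord R θbar (schedDelta δ₀ δ₁ N) 𝒞).weight (k + 1) U)
      (fun φ => ∑ X ∈ largePartIndex (L ^ k) L U,
        (bprod (L ^ k) (fun B => expNegH Ht B φ) (U \ X) * bprod (L ^ k) (fun B => expNegH (-Ht) B φ) (X \ U) *
            (fluct 𝒞a (polyP2 (L ^ k) H K X) φ + bprod (L ^ k) (fun B => 1 - expNegH Ht B φ) X) -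
          bprod (L ^ k) (fun B => expNegH Ht B φ) (U \ X) * bprod (L ^ k) (fun B => expNegH (-Ht) B φ) (X \ U) *
            (fluct 𝒞b (polyP2 (L ^ k) H K X) φ + bprod (L ^ k) (fun B => 1 - expNegH Ht B φ) X)))
      (ℓ *
      ((κ ^ (blocks (L ^ k) U).card *
          ((8 * Real.exp (1 / 4) * hamNorm (fieldWt h (L : ℝ) d k) ((L : ℝ) ^ k) (L ^ (d * k)) H + C) *
            (ω * A ^ 4)) *
        (((2 * (2 * κ * max 1 (max A𝒫a κp))) ^ ((2 ^ (d + 1) + 2) ^ d * L ^ d) * (4 : ℝ) ^ ((2 ^ (d + 1) + 2) ^ d * L ^ d)) ^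
            (blocks (L * L ^ k) U).card *
          A ^ (-((1 + 1 / ((2 * (2 ^ d + 1) + 6 : ℝ) ^ d)) * (blocks (L * L ^ k) U).card) : ℝ)) +
      κ ^ (blocks (L ^ k) U).card * C *
        (((2 * κ * max 1 (max A𝒫a κp)) ^ ((2 ^ (d + 1) + 2) ^ d * L ^ d) * (2 : ℝ) ^ ((2 ^ (d + 1) + 2) ^ d * L ^ d)) ^
            (blocks (L * L ^ k) U).card *
          A ^ (-((1 + 1 / ((2 * (2 ^ d + 1) + 6 : ℝ) ^ d)) * (blocks (L * L ^ k) U).card) : ℝ))))) := by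
  have hA : 0 < A := by linarith
  set P := abkmNormParams L N Mord R p r₀ h θbar A (schedDelta δ₀ δ₁ N) 𝒞 with hP
  set A𝒫m : ℝ := max A𝒫a κp with hA𝒫m
  have hA𝒫m0 : 0 ≤ A𝒫m := le_max_of_le_left hA𝒫
  have hκpm : κp ≤ A𝒫m := le_max_right _ _
  have hSa' : StepKernelBounds (abkmWeightData L N Mord R θbar (schedDelta δ₀ δ₁ N) 𝒞) L k A𝒫m C₂a 𝒞a :=
    hSa.mono_A𝒫 hA𝒫 (le_max_left _ _)
  set T := (polys (L ^ k) univ).filter (fun X => reblock (L ^ k) (L * L ^ k) X = U) with hT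
  set T₂ := largePartIndex (L ^ k) L U with hT₂
  have hT₂T : T₂ ⊆ T := by
    intro X hX
    obtain ⟨hXp, -, -, hXU⟩ := mem_largePartIndex.1 hX
    exact mem_filter.2 ⟨mem_polys.2 ⟨subset_univ _, hXp⟩, hXU⟩
  have hT₂p : ∀ X ∈ T₂, IsPolymer (L ^ k) X := fun X hX => (mem_largePartIndex.1 hX).1
  have hT₂c : ∀ X ∈ T₂, IsConn X := fun X hX => (mem_largePartIndex.1 hX).2.1
  have hT₂two : ∀ X ∈ T₂, 2 ≤ (blocks (L ^ k) X).card := fun X hX => (mem_largePartIndex.1 hX).2.2.1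
  have hT₂ne : ∀ X ∈ T₂, X.Nonempty := fun X hX => (hT₂c X hX).1
  have h𝓨 : ∀ X ∈ T₂, ({∅, X} : Finset (Finset (Fin d → ZMod M))) ⊆ polys (L ^ k) X := by
    intro X hX X₁ hX₁
    rcases mem_insert.1 hX₁ with rfl | h1
    · exact empty_mem_polys _ _
    · rw [mem_singleton.1 h1]; exact self_mem_polys (hT₂p X hX)
  -- the explicit per-term two-kernel bound (same `H̃` on both sides), summed over `X₁ ∈ {∅, X}`
  have htool := tayNormLE_subsum_reblockTerm_kernel_sub_abkm (n := n) (lam := lam) (μ := μ) hd hLodd hL hR2 hM hkN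
    hSa' hSb hp hMord hB hδ₀ hδ₁ hh hh0 hA𝒫m0 hA hU (𝓧' := T₂) hT₂T
    (𝓨 := fun X => ({∅, X} : Finset (Finset (Fin d → ZMod M)))) h𝓨
    hHt hHt hτ hH hC hK hKfac hK0 hKd hKloc hℓ hκp hdiff
  -- the two reblocked terms `X₁ = ∅`, `X₁ = X` of a preimage are the `Σ₂ᴸ` summand
  have hfun : (fun φ : (Fin d → ZMod M) → ℝ => ∑ X ∈ T₂, ∑ X₁ ∈ ({∅, X} : Finset (Finset (Fin d → ZMod M))),
      (bprod (L ^ k) (fun B => expNegH Ht B φ) (U \ X) * bprod (L ^ k) (fun B => expNegH (-Ht) B φ) (X \ U) *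
          (bprod (L ^ k) (fun B => 1 - expNegH Ht B φ) X₁ * fluct 𝒞a (polyP2 (L ^ k) H K (X \ X₁)) φ) -
        bprod (L ^ k) (fun B => expNegH Ht B φ) (U \ X) * bprod (L ^ k) (fun B => expNegH (-Ht) B φ) (X \ U) *
          (bprod (L ^ k) (fun B => 1 - expNegH Ht B φ) X₁ *
            fluct 𝒞b (polyP2 (L ^ k) H K (X \ X₁)) φ))) =
      fun φ => ∑ X ∈ T₂,
        (bprod (L ^ k) (fun B => expNegH Ht B φ) (U \ X) * bprod (L ^ k) (fun B => expNegH (-Ht) B φ) (X \ U) *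
            (fluct 𝒞a (polyP2 (L ^ k) H K X) φ + bprod (L ^ k) (fun B => 1 - expNegH Ht B φ) X) -
          bprod (L ^ k) (fun B => expNegH Ht B φ) (U \ X) * bprod (L ^ k) (fun B => expNegH (-Ht) B φ) (X \ U) *
            (fluct 𝒞b (polyP2 (L ^ k) H K X) φ + bprod (L ^ k) (fun B => 1 - expNegH Ht B φ) X)) := by
    funext φ
    refine sum_congr rfl fun X hX => ?_
    rw [sum_pair (hT₂ne X hX).ne_empty.symm]
    simp only [bprod_empty, sdiff_empty, Finset.sdiff_self, polyP2_empty _ _ hK0, fluct_const]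
    ring
  rw [hfun] at htool
  refine htool.mono ?_ (fun _ => (Real.exp_pos _).le)
  -- sizes and parities
  have h2dle : 2 ^ d ≤ 2 ^ (d + 3) := Nat.pow_le_pow_right (by norm_num) (by omega)
  have h1le : 1 ≤ 2 ^ d := Nat.one_le_two_pow
  have hL2 : 2 ^ d + 1 ≤ L := by omega
  have hL4 : 4 ≤ L := by omega
  have hMo : Odd M := by rw [hM]; exact hLodd.pow
  have hsodd : Odd (L ^ k) := hLodd.pow
  have hU' : IsPolymer (L * L ^ k) U := by
    rw [show L * L ^ k = L ^ (k + 1) by rw [pow_succ']]; exact hU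
  -- nonnegativity of the letters; the `H̃`-difference letter vanishes (`H̃' = H̃`)
  have hnn : ∀ H₀ : RelevantHamiltonian ℂ d,
      0 ≤ hamNorm (fieldWt h (L : ℝ) d k) ((L : ℝ) ^ k) (L ^ (d * k)) H₀ := fun H₀ =>
    hamNorm_nonneg (fieldWt_pos hh (by exact_mod_cast hLodd.pos) d k).le (by positivity) _ H₀
  have hΔ0 : hamNorm (fieldWt h (L : ℝ) d k) ((L : ℝ) ^ k) (L ^ (d * k)) (Ht - Ht) = 0 := by
    rw [sub_self, hamNorm_zero]
  have hτ0 : 0 ≤ τ := (hnn Ht).trans hHt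
  have haF : ∀ Z, P.aFactor k Z = (A ^ (blocks (L ^ k) Z).card)⁻¹ := fun Z => by
    rw [hP, NormParams.aFactor, abkmNormParams_A, abkmNormParams_L, card_blocks_eq_numBlocks]
  have h3 : 0 ≤ (16 * Real.exp (3 / 8) * hamNorm (fieldWt h (L : ℝ) d k) ((L : ℝ) ^ k) (L ^ (d * k)) (Ht - Ht)) := mul_nonneg (by positivity) (hnn _)
  have hθω' : 8 * Real.exp (1 / 4) * τ +
      16 * Real.exp (3 / 8) * hamNorm (fieldWt h (L : ℝ) d k) ((L : ℝ) ^ k) (L ^ (d * k)) (Ht - Ht) ≤ ω := by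
    rw [hΔ0, mul_zero, add_zero]; exact hθω
  have hbω : 8 * Real.exp (1 / 4) * hamNorm (fieldWt h (L : ℝ) d k) ((L : ℝ) ^ k) (L ^ (d * k)) H ≤ ω :=
    le_trans (le_add_of_nonneg_right (by have := hnn H; positivity)) hbbω
  have hκ' : 1 + Real.exp (1 / 4) +
      16 * Real.exp (3 / 8) * hamNorm (fieldWt h (L : ℝ) d k) ((L : ℝ) ^ k) (L ^ (d * k)) (Ht - Ht) ≤ κ := by
    rw [hΔ0, mul_zero, add_zero]; exact hκ
  have hκ1 : 1 ≤ κ := by have := Real.exp_pos (1 / 4 : ℝ); linarith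
  have hκ0 : 0 ≤ κ := by linarith
  have hω0 : 0 ≤ ω := le_trans (by have := hnn H; positivity) hbω
  -- the two constants `E` (ω-small part) and `E₂` (top terms), written with the (vanishing) `Δ`-letter
  set E : ℝ := κ ^ (blocks (L ^ k) U).card * ((3 * (16 * Real.exp (3 / 8) * hamNorm (fieldWt h (L : ℝ) d k) ((L : ℝ) ^ k) (L ^ (d * k)) (Ht - Ht)) + 8 * Real.exp (1 / 4) * hamNorm (fieldWt h (L : ℝ) d k) ((L : ℝ) ^ k) (L ^ (d * k)) H + C) * (ω * A ^ 4)) with hE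
  set E₂ : ℝ := κ ^ (blocks (L ^ k) U).card * (2 * (16 * Real.exp (3 / 8) * hamNorm (fieldWt h (L : ℝ) d k) ((L : ℝ) ^ k) (L ^ (d * k)) (Ht - Ht)) + C) with hE₂
  have hE0 : 0 ≤ E := by have h2 := hnn H; rw [hE]; positivity
  have hE₂0 : 0 ≤ E₂ := by rw [hE₂]; positivity
  have hc1 : (1 : ℝ) ≤ 2 * κ * max 1 A𝒫m := by
    have hm1 := le_max_left (1 : ℝ) A𝒫m
    have hκm : (1 : ℝ) * 1 ≤ κ * max 1 A𝒫m := mul_le_mul hκ1 hm1 zero_le_one (by linarith)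
    linarith
  set c : ℝ := 2 * κ * max 1 A𝒫m with hc
  -- the majorants
  set G : Finset (Fin d → ZMod M) → Finset (Fin d → ZMod M) → ℝ := fun X Y =>
    c ^ (blocks (L ^ k) X).card * E *
      (A ^ (2 * (blocks (L ^ k) (X \ Y)).card + (blocks (L ^ k) Y).card + (components Y).card))⁻¹ with hG
  set 𝓩 : Finset (Fin d → ZMod M) → Finset (Fin d → ZMod M) → Finset (Finset (Fin d → ZMod M)) :=
    fun X X₁ => if X₁ = ∅ then (polys (L ^ k) (X \ X₁)).erase X else polys (L ^ k) (X \ X₁) with h𝓩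
  have h𝓩sub : ∀ X ∈ T₂, ∀ X₁ ∈ ({∅, X} : Finset (Finset (Fin d → ZMod M))), 𝓩 X X₁ ⊆ polys (L ^ k) (X \ X₁) := by
    intro X _ X₁ _
    simp only [h𝓩]
    split_ifs
    · exact erase_subset _ _
    · exact Subset.rfl
  -- Step 1: per `X`, the two adapters (letters `Δ := 16e^{3/8}‖H̃ − H̃‖ = 0`, `Δ_H := 8e^{1/4}‖H‖`, `C_Δ := C`)
  have hstep : ∀ X ∈ T₂,
      ∑ X₁ ∈ ({∅, X} : Finset (Finset (Fin d → ZMod M))),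
        (((∏ _B ∈ blocks (L ^ k) (U \ X), (Real.exp (1 / 4) + (16 * Real.exp (3 / 8) * hamNorm (fieldWt h (L : ℝ) d k) ((L : ℝ) ^ k) (L ^ (d * k)) (Ht - Ht)))) -
            ∏ _B ∈ blocks (L ^ k) (U \ X), Real.exp (1 / 4)) *
            (∏ _B ∈ blocks (L ^ k) (X \ U), Real.exp (1 / 4)) *
            ((∏ _B ∈ blocks (L ^ k) X₁, 8 * Real.exp (1 / 4) * τ) *
              ((∑ Y ∈ polys (L ^ k) (X \ X₁), (∏ _B ∈ blocks (L ^ k) ((X \ X₁) \ Y),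
                8 * Real.exp (1 / 4) * hamNorm (fieldWt h (L : ℝ) d k) ((L : ℝ) ^ k) (L ^ (d * k)) H) *
                ∏ Z ∈ components Y, C * P.aFactor k Z) *
                A𝒫m ^ numBlocks (L ^ k) (X \ X₁))) +
          (∏ _B ∈ blocks (L ^ k) (U \ X), Real.exp (1 / 4)) *
            ((∏ _B ∈ blocks (L ^ k) (X \ U), (Real.exp (1 / 4) + (16 * Real.exp (3 / 8) * hamNorm (fieldWt h (L : ℝ) d k) ((L : ℝ) ^ k) (L ^ (d * k)) (Ht - Ht)))) -
              ∏ _B ∈ blocks (L ^ k) (X \ U), Real.exp (1 / 4)) *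
            ((∏ _B ∈ blocks (L ^ k) X₁, 8 * Real.exp (1 / 4) * τ) *
              ((∑ Y ∈ polys (L ^ k) (X \ X₁), (∏ _B ∈ blocks (L ^ k) ((X \ X₁) \ Y),
                8 * Real.exp (1 / 4) * hamNorm (fieldWt h (L : ℝ) d k) ((L : ℝ) ^ k) (L ^ (d * k)) H) *
                ∏ Z ∈ components Y, C * P.aFactor k Z) *
                A𝒫m ^ numBlocks (L ^ k) (X \ X₁))) +
          (∏ _B ∈ blocks (L ^ k) (U \ X), Real.exp (1 / 4)) * (∏ _B ∈ blocks (L ^ k) (X \ U), Real.exp (1 / 4)) *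
            (((∏ _B ∈ blocks (L ^ k) X₁, (8 * Real.exp (1 / 4) * τ + (16 * Real.exp (3 / 8) * hamNorm (fieldWt h (L : ℝ) d k) ((L : ℝ) ^ k) (L ^ (d * k)) (Ht - Ht)))) -
              ∏ _B ∈ blocks (L ^ k) X₁, 8 * Real.exp (1 / 4) * τ) *
              ((∑ Y ∈ polys (L ^ k) (X \ X₁), (∏ _B ∈ blocks (L ^ k) ((X \ X₁) \ Y),
                8 * Real.exp (1 / 4) * hamNorm (fieldWt h (L : ℝ) d k) ((L : ℝ) ^ k) (L ^ (d * k)) H) *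
                ∏ Z ∈ components Y, C * P.aFactor k Z) *
                A𝒫m ^ numBlocks (L ^ k) (X \ X₁))) +
          (∏ _B ∈ blocks (L ^ k) (U \ X), Real.exp (1 / 4)) * (∏ _B ∈ blocks (L ^ k) (X \ U), Real.exp (1 / 4)) *
            ((∏ _B ∈ blocks (L ^ k) X₁, 8 * Real.exp (1 / 4) * τ) *
              ((∑ Y ∈ polys (L ^ k) (X \ X₁),
                (((∏ _B ∈ blocks (L ^ k) ((X \ X₁) \ Y),
                    (8 * Real.exp (1 / 4) * hamNorm (fieldWt h (L : ℝ) d k) ((L : ℝ) ^ k) (L ^ (d * k)) H + 8 * Real.exp (1 / 4) * hamNorm (fieldWt h (L : ℝ) d k) ((L : ℝ) ^ k) (L ^ (d * k)) H)) -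
                  ∏ _B ∈ blocks (L ^ k) ((X \ X₁) \ Y),
                    8 * Real.exp (1 / 4) * hamNorm (fieldWt h (L : ℝ) d k) ((L : ℝ) ^ k) (L ^ (d * k)) H) *
                  ∏ Z ∈ components Y, C * P.aFactor k Z +
                (∏ _B ∈ blocks (L ^ k) ((X \ X₁) \ Y),
                    8 * Real.exp (1 / 4) * hamNorm (fieldWt h (L : ℝ) d k) ((L : ℝ) ^ k) (L ^ (d * k)) H) *
                  ((∏ Z ∈ components Y, (C * P.aFactor k Z + C * P.aFactor k Z)) -
                    ∏ Z ∈ components Y, C * P.aFactor k Z))) *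
                A𝒫m ^ numBlocks (L ^ k) (X \ X₁)))) ≤
        (∑ X₁ ∈ ({∅, X} : Finset (Finset (Fin d → ZMod M))), ∑ Y ∈ 𝓩 X X₁, G X Y) +
          c ^ (blocks (L ^ k) X).card * E₂ * (A ^ (blocks (L ^ k) X).card)⁻¹ := by
    intro X hX
    have hXp := hT₂p X hX
    have hXne : (∅ : Finset (Fin d → ZMod M)) ≠ X := (hT₂ne X hX).ne_empty.symm
    rw [sum_pair hXne, sum_pair hXne]
    have h𝓩0 : 𝓩 X ∅ = (polys (L ^ k) (X \ ∅)).erase X := by simp only [h𝓩, if_pos rfl]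
    have h𝓩X : 𝓩 X X = polys (L ^ k) (X \ X) := by simp only [h𝓩, if_neg hXne.symm]
    rw [h𝓩0, h𝓩X]
    -- `X₁ = ∅`: the top-term adapter
    have hAempty := reblockTerm_lipschitzConsts_le_top (U := U) (X := X) (X₁ := (∅ : Finset (Fin d → ZMod M)))
      hMo hsodd hA1 (Real.exp_pos _).le
      h3 (by positivity) (by have := hnn H; positivity)
      (by have := hnn H; positivity) (by have := hnn H; positivity) hC hC hA𝒫m0 hθω' hbω hbbω hCω hωA hκ'
      haF hXp rfl (hT₂two X hX)
    -- `X₁ = X`: the ordinary adapter (`𝓟(X∖X) = {∅}`, degree `|X|_k ≥ 2`)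
    have hdegX : ∀ Y ∈ polys (L ^ k) (X \ X), 2 ≤ (blocks (L ^ k) (X \ Y)).card + (components Y).card := by
      intro Y hY
      rw [Finset.sdiff_self, polys_empty, mem_singleton] at hY
      subst hY
      rw [sdiff_empty]
      exact (hT₂two X hX).trans (Nat.le_add_right _ _)
    have hAX := reblockTerm_lipschitzConsts_le (U := U) (X := X) (X₁ := X) hMo hsodd hA1 (Real.exp_pos _).le
      h3 (by positivity) (by have := hnn H; positivity)
      (by have := hnn H; positivity) (by have := hnn H; positivity) hC hC hA𝒫m0 hθω' hbω hbbω hCω hωA hκ'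
      haF hXp (self_mem_polys hXp) hdegX
    have hsum : (∑ Y ∈ (polys (L ^ k) (X \ ∅)).erase X, G X Y) +
        c ^ (blocks (L ^ k) X).card * E₂ * (A ^ (blocks (L ^ k) X).card)⁻¹ + ∑ Y ∈ polys (L ^ k) (X \ X), G X Y =
        (∑ Y ∈ (polys (L ^ k) (X \ ∅)).erase X, G X Y) + ∑ Y ∈ polys (L ^ k) (X \ X), G X Y +
          c ^ (blocks (L ^ k) X).card * E₂ * (A ^ (blocks (L ^ k) X).card)⁻¹ := by ring
    rw [← hsum]
    exact add_le_add hAempty hAX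
  -- Step 2: the three `H̃`-variation summands vanish and the kernel slot is `ℓ` times the letter slot
  have hnnH := hnn H
  have hea : 0 ≤ Real.exp (1 / 4 : ℝ) := (Real.exp_pos _).le
  have haF0 : ∀ Z, 0 ≤ P.aFactor k Z := fun Z => by rw [haF Z]; positivity
  have hGs0 : ∀ X₂ : Finset (Fin d → ZMod M), 0 ≤ ∑ Y ∈ polys (L ^ k) X₂, (∏ _B ∈ blocks (L ^ k) (X₂ \ Y),
      8 * Real.exp (1 / 4) * hamNorm (fieldWt h (L : ℝ) d k) ((L : ℝ) ^ k) (L ^ (d * k)) H) *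
      ∏ Z ∈ components Y, C * P.aFactor k Z := fun X₂ =>
    sum_nonneg fun Y _ => mul_nonneg (prod_nonneg fun _ _ => by positivity)
      (prod_nonneg fun Z _ => mul_nonneg hC (haF0 Z))
  have hLs0 : ∀ X₂ : Finset (Fin d → ZMod M), 0 ≤ ∑ Y ∈ polys (L ^ k) X₂,
      (((∏ _B ∈ blocks (L ^ k) (X₂ \ Y),
          (8 * Real.exp (1 / 4) * hamNorm (fieldWt h (L : ℝ) d k) ((L : ℝ) ^ k) (L ^ (d * k)) H +
            8 * Real.exp (1 / 4) * hamNorm (fieldWt h (L : ℝ) d k) ((L : ℝ) ^ k) (L ^ (d * k)) H)) -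
          ∏ _B ∈ blocks (L ^ k) (X₂ \ Y), 8 * Real.exp (1 / 4) * hamNorm (fieldWt h (L : ℝ) d k) ((L : ℝ) ^ k) (L ^ (d * k)) H) *
        ∏ Z ∈ components Y, C * P.aFactor k Z +
      (∏ _B ∈ blocks (L ^ k) (X₂ \ Y), 8 * Real.exp (1 / 4) * hamNorm (fieldWt h (L : ℝ) d k) ((L : ℝ) ^ k) (L ^ (d * k)) H) *
        ((∏ Z ∈ components Y, (C * P.aFactor k Z + C * P.aFactor k Z)) - ∏ Z ∈ components Y, C * P.aFactor k Z)) := by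
    intro X₂
    refine sum_nonneg fun Y _ => add_nonneg (mul_nonneg ?_ (prod_nonneg fun Z _ => mul_nonneg hC (haF0 Z)))
      (mul_nonneg (prod_nonneg fun _ _ => by positivity) ?_)
    · exact sub_nonneg.2 (prod_le_prod (fun _ _ => by positivity)
        (fun _ _ => le_add_of_nonneg_right (by positivity)))
    · exact sub_nonneg.2 (prod_le_prod (fun Z _ => mul_nonneg hC (haF0 Z))
        (fun Z _ => by linarith [mul_nonneg hC (haF0 Z)]))
  have hprodD : ∀ (S : Finset (Finset (Fin d → ZMod M))) (x y : ℝ), 0 ≤ x → 0 ≤ y →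
      0 ≤ (∏ _B ∈ S, (x + y)) - ∏ _B ∈ S, x := fun S x y hx hy =>
    sub_nonneg.2 (prod_le_prod (fun _ _ => hx) (fun _ _ => by linarith))
  have hprod0 : ∀ (S : Finset (Finset (Fin d → ZMod M))) (x : ℝ),
      (∏ _B ∈ S, (x + 16 * Real.exp (3 / 8) * hamNorm (fieldWt h (L : ℝ) d k) ((L : ℝ) ^ k) (L ^ (d * k)) (Ht - Ht))) -
        ∏ _B ∈ S, x = 0 := fun S x => by
    rw [hΔ0, mul_zero, add_zero, sub_self]
  have four_le : ∀ (S s4m s4L : ℝ), 0 ≤ S → s4m ≤ ℓ * s4L → 0 + 0 + 0 + s4m ≤ ℓ * (S + s4L) := by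
    intro S s4m s4L hS h; nlinarith
  have hmaj : ∀ X ∈ T₂, ∀ X₁ ∈ ({∅, X} : Finset (Finset (Fin d → ZMod M))),
        (((∏ _B ∈ blocks (L ^ k) (U \ X), (Real.exp (1 / 4) +
              16 * Real.exp (3 / 8) * hamNorm (fieldWt h (L : ℝ) d k) ((L : ℝ) ^ k) (L ^ (d * k)) (Ht - Ht))) -
            ∏ _B ∈ blocks (L ^ k) (U \ X), Real.exp (1 / 4)) *
            (∏ _B ∈ blocks (L ^ k) (X \ U), Real.exp (1 / 4)) *
            ((∏ _B ∈ blocks (L ^ k) X₁, 8 * Real.exp (1 / 4) * τ) *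
              ((∑ Y ∈ polys (L ^ k) (X \ X₁), (∏ _B ∈ blocks (L ^ k) ((X \ X₁) \ Y),
                8 * Real.exp (1 / 4) * hamNorm (fieldWt h (L : ℝ) d k) ((L : ℝ) ^ k) (L ^ (d * k)) H) *
                ∏ Z ∈ components Y, C *
                  P.aFactor k Z) *
                A𝒫m ^ numBlocks (L ^ k) (X \ X₁))) +
          (∏ _B ∈ blocks (L ^ k) (U \ X), Real.exp (1 / 4)) *
            ((∏ _B ∈ blocks (L ^ k) (X \ U), (Real.exp (1 / 4) +
              16 * Real.exp (3 / 8) * hamNorm (fieldWt h (L : ℝ) d k) ((L : ℝ) ^ k) (L ^ (d * k)) (Ht - Ht))) -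
              ∏ _B ∈ blocks (L ^ k) (X \ U), Real.exp (1 / 4)) *
            ((∏ _B ∈ blocks (L ^ k) X₁, 8 * Real.exp (1 / 4) * τ) *
              ((∑ Y ∈ polys (L ^ k) (X \ X₁), (∏ _B ∈ blocks (L ^ k) ((X \ X₁) \ Y),
                8 * Real.exp (1 / 4) * hamNorm (fieldWt h (L : ℝ) d k) ((L : ℝ) ^ k) (L ^ (d * k)) H) *
                ∏ Z ∈ components Y, C *
                  P.aFactor k Z) *
                A𝒫m ^ numBlocks (L ^ k) (X \ X₁))) +
          (∏ _B ∈ blocks (L ^ k) (U \ X), Real.exp (1 / 4)) * (∏ _B ∈ blocks (L ^ k) (X \ U), Real.exp (1 / 4)) *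
            (((∏ _B ∈ blocks (L ^ k) X₁, (8 * Real.exp (1 / 4) * τ +
                16 * Real.exp (3 / 8) * hamNorm (fieldWt h (L : ℝ) d k) ((L : ℝ) ^ k) (L ^ (d * k)) (Ht - Ht))) -
              ∏ _B ∈ blocks (L ^ k) X₁, 8 * Real.exp (1 / 4) * τ) *
              ((∑ Y ∈ polys (L ^ k) (X \ X₁), (∏ _B ∈ blocks (L ^ k) ((X \ X₁) \ Y),
                8 * Real.exp (1 / 4) * hamNorm (fieldWt h (L : ℝ) d k) ((L : ℝ) ^ k) (L ^ (d * k)) H) *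
                ∏ Z ∈ components Y, C *
                  P.aFactor k Z) *
                A𝒫m ^ numBlocks (L ^ k) (X \ X₁))) +
          (∏ _B ∈ blocks (L ^ k) (U \ X), Real.exp (1 / 4)) * (∏ _B ∈ blocks (L ^ k) (X \ U), Real.exp (1 / 4)) *
            ((∏ _B ∈ blocks (L ^ k) X₁, 8 * Real.exp (1 / 4) * τ) *
              (if X \ X₁ = ∅ then 0 else
                (∑ Y ∈ polys (L ^ k) (X \ X₁), (∏ _B ∈ blocks (L ^ k) ((X \ X₁) \ Y),
                  8 * Real.exp (1 / 4) * hamNorm (fieldWt h (L : ℝ) d k) ((L : ℝ) ^ k) (L ^ (d * k)) H) *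
                  ∏ Z ∈ components Y, C *
                    P.aFactor k Z) *
                  ℓ * κp ^ numBlocks (L ^ k) (X \ X₁)))) ≤
      ℓ *
      (        (((∏ _B ∈ blocks (L ^ k) (U \ X), (Real.exp (1 / 4) + (16 * Real.exp (3 / 8) * hamNorm (fieldWt h (L : ℝ) d k) ((L : ℝ) ^ k) (L ^ (d * k)) (Ht - Ht)))) -
            ∏ _B ∈ blocks (L ^ k) (U \ X), Real.exp (1 / 4)) *
            (∏ _B ∈ blocks (L ^ k) (X \ U), Real.exp (1 / 4)) *
            ((∏ _B ∈ blocks (L ^ k) X₁, 8 * Real.exp (1 / 4) * τ) *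
              ((∑ Y ∈ polys (L ^ k) (X \ X₁), (∏ _B ∈ blocks (L ^ k) ((X \ X₁) \ Y),
                8 * Real.exp (1 / 4) * hamNorm (fieldWt h (L : ℝ) d k) ((L : ℝ) ^ k) (L ^ (d * k)) H) *
                ∏ Z ∈ components Y, C * P.aFactor k Z) *
                A𝒫m ^ numBlocks (L ^ k) (X \ X₁))) +
          (∏ _B ∈ blocks (L ^ k) (U \ X), Real.exp (1 / 4)) *
            ((∏ _B ∈ blocks (L ^ k) (X \ U), (Real.exp (1 / 4) + (16 * Real.exp (3 / 8) * hamNorm (fieldWt h (L : ℝ) d k) ((L : ℝ) ^ k) (L ^ (d * k)) (Ht - Ht)))) -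
              ∏ _B ∈ blocks (L ^ k) (X \ U), Real.exp (1 / 4)) *
            ((∏ _B ∈ blocks (L ^ k) X₁, 8 * Real.exp (1 / 4) * τ) *
              ((∑ Y ∈ polys (L ^ k) (X \ X₁), (∏ _B ∈ blocks (L ^ k) ((X \ X₁) \ Y),
                8 * Real.exp (1 / 4) * hamNorm (fieldWt h (L : ℝ) d k) ((L : ℝ) ^ k) (L ^ (d * k)) H) *
                ∏ Z ∈ components Y, C * P.aFactor k Z) *
                A𝒫m ^ numBlocks (L ^ k) (X \ X₁))) +
          (∏ _B ∈ blocks (L ^ k) (U \ X), Real.exp (1 / 4)) * (∏ _B ∈ blocks (L ^ k) (X \ U), Real.exp (1 / 4)) *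
            (((∏ _B ∈ blocks (L ^ k) X₁, (8 * Real.exp (1 / 4) * τ + (16 * Real.exp (3 / 8) * hamNorm (fieldWt h (L : ℝ) d k) ((L : ℝ) ^ k) (L ^ (d * k)) (Ht - Ht)))) -
              ∏ _B ∈ blocks (L ^ k) X₁, 8 * Real.exp (1 / 4) * τ) *
              ((∑ Y ∈ polys (L ^ k) (X \ X₁), (∏ _B ∈ blocks (L ^ k) ((X \ X₁) \ Y),
                8 * Real.exp (1 / 4) * hamNorm (fieldWt h (L : ℝ) d k) ((L : ℝ) ^ k) (L ^ (d * k)) H) *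
                ∏ Z ∈ components Y, C * P.aFactor k Z) *
                A𝒫m ^ numBlocks (L ^ k) (X \ X₁))) +
          (∏ _B ∈ blocks (L ^ k) (U \ X), Real.exp (1 / 4)) * (∏ _B ∈ blocks (L ^ k) (X \ U), Real.exp (1 / 4)) *
            ((∏ _B ∈ blocks (L ^ k) X₁, 8 * Real.exp (1 / 4) * τ) *
              ((∑ Y ∈ polys (L ^ k) (X \ X₁),
                (((∏ _B ∈ blocks (L ^ k) ((X \ X₁) \ Y),
                    (8 * Real.exp (1 / 4) * hamNorm (fieldWt h (L : ℝ) d k) ((L : ℝ) ^ k) (L ^ (d * k)) H + 8 * Real.exp (1 / 4) * hamNorm (fieldWt h (L : ℝ) d k) ((L : ℝ) ^ k) (L ^ (d * k)) H)) -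
                  ∏ _B ∈ blocks (L ^ k) ((X \ X₁) \ Y),
                    8 * Real.exp (1 / 4) * hamNorm (fieldWt h (L : ℝ) d k) ((L : ℝ) ^ k) (L ^ (d * k)) H) *
                  ∏ Z ∈ components Y, C * P.aFactor k Z +
                (∏ _B ∈ blocks (L ^ k) ((X \ X₁) \ Y),
                    8 * Real.exp (1 / 4) * hamNorm (fieldWt h (L : ℝ) d k) ((L : ℝ) ^ k) (L ^ (d * k)) H) *
                  ((∏ Z ∈ components Y, (C * P.aFactor k Z + C * P.aFactor k Z)) -
                    ∏ Z ∈ components Y, C * P.aFactor k Z))) *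
                A𝒫m ^ numBlocks (L ^ k) (X \ X₁))))) := by
    intro X hX X₁ hX₁
    have hkey := kernelSlot_le_letterSlot (L ^ k) (b := 8 * Real.exp (1 / 4) *
      hamNorm (fieldWt h (L : ℝ) d k) ((L : ℝ) ^ k) (L ^ (d * k)) H) (C := C) (by positivity) hC hℓ hκp hκpm haF0 (X \ X₁)
    rw [hprod0 (blocks (L ^ k) (U \ X)) (Real.exp (1 / 4)), hprod0 (blocks (L ^ k) (X \ U)) (Real.exp (1 / 4)),
      hprod0 (blocks (L ^ k) X₁) (8 * Real.exp (1 / 4) * τ)]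
    simp only [zero_mul, mul_zero]
    have hp1 : 0 ≤ ∏ _B ∈ blocks (L ^ k) (U \ X), Real.exp (1 / 4) := prod_nonneg fun _ _ => hea
    have hp2 : 0 ≤ ∏ _B ∈ blocks (L ^ k) (X \ U), Real.exp (1 / 4) := prod_nonneg fun _ _ => hea
    have hp3 : 0 ≤ ∏ _B ∈ blocks (L ^ k) X₁, 8 * Real.exp (1 / 4) * τ := prod_nonneg fun _ _ => by positivity
    refine four_le _ _ _ (by norm_num) ?_
    · calc (∏ _B ∈ blocks (L ^ k) (U \ X), Real.exp (1 / 4)) * (∏ _B ∈ blocks (L ^ k) (X \ U), Real.exp (1 / 4)) *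
            ((∏ _B ∈ blocks (L ^ k) X₁, 8 * Real.exp (1 / 4) * τ) *
              (if X \ X₁ = ∅ then 0 else
                (∑ Y ∈ polys (L ^ k) (X \ X₁), (∏ _B ∈ blocks (L ^ k) ((X \ X₁) \ Y),
                  8 * Real.exp (1 / 4) * hamNorm (fieldWt h (L : ℝ) d k) ((L : ℝ) ^ k) (L ^ (d * k)) H) *
                  ∏ Z ∈ components Y, C *
                    P.aFactor k Z) *
                  ℓ * κp ^ numBlocks (L ^ k) (X \ X₁)))
          ≤ (∏ _B ∈ blocks (L ^ k) (U \ X), Real.exp (1 / 4)) * (∏ _B ∈ blocks (L ^ k) (X \ U), Real.exp (1 / 4)) *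
            ((∏ _B ∈ blocks (L ^ k) X₁, 8 * Real.exp (1 / 4) * τ) * (ℓ * _)) :=
            mul_le_mul_of_nonneg_left (mul_le_mul_of_nonneg_left hkey hp3) (mul_nonneg hp1 hp2)
        _ = _ := by ring
  refine (sum_le_sum fun X hX => sum_le_sum fun X₁ hX₁ => hmaj X hX X₁ hX₁).trans ?_
  simp_rw [← mul_sum]
  -- the statement's constants are `E`, `E₂` with the vanishing `Δ`-letter erased
  have hEeq : κ ^ (blocks (L ^ k) U).card *
      ((8 * Real.exp (1 / 4) * hamNorm (fieldWt h (L : ℝ) d k) ((L : ℝ) ^ k) (L ^ (d * k)) H + C) * (ω * A ^ 4)) = E := by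
    rw [hE, hΔ0]; ring
  have hE₂eq : κ ^ (blocks (L ^ k) U).card * C = E₂ := by
    rw [hE₂, hΔ0]; ring
  rw [hEeq, hE₂eq]
  refine mul_le_mul_of_nonneg_left ?_ hℓ
  -- Step 3: sum over `X` and the two master bounds (one-kernel counting, letters)
  refine (sum_le_sum hstep).trans ?_
  rw [sum_add_distrib]
  refine add_le_add ?_ ?_
  · have hm := sum_reblock_triples_le_pow (d := d) hLodd hL2 hL4 hM hkN hA1 hc1 hE0 hU' (𝓧' := T₂) hT₂T
      (𝓨 := fun X => ({∅, X} : Finset (Finset (Fin d → ZMod M)))) h𝓨 (𝓩 := 𝓩) h𝓩sub (F := fun X _ Y => G X Y)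
      (fun X _ X₁ _ Y _ => by simp only [hG]; exact le_rfl)
    simpa only [hE, hc] using hm
  · have hm := sum_reblock_large_le_pow (d := d) hLodd hL2 hL4 hM hkN hA1 hc1 hE₂0 hU' (𝓧'' := T₂) hT₂T hT₂c
      hT₂two (F := fun X => c ^ (blocks (L ^ k) X).card * E₂ * (A ^ (blocks (L ^ k) X).card)⁻¹)
      (fun X _ => le_rfl)
    simpa only [hE₂, hc] using hm

end Literature.MathematicalPhysics.StatisticalMechanics.GradientRG

end
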